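import Literature.MathematicalPhysics.QuantumFieldTheory.Balaban1983to89.B7Ineq148
import Literature.MathematicalPhysics.QuantumFieldTheory.Balaban1983to89.B7Prop5Induction

/-!
# `Balaban1983to89.B7Ineq148Seam` — B7 = T. Bałaban, *Averaging operations for lattice gauge
# theories*, Commun. Math. Phys. **98**, 17–51 (1985): the seam between the typed one-step bound (148)
# (`B7Ineq148.Ineq148Printed`, unit pv23) and the hypothesis `ht₂` of the induction step (153)–(154)
# (`B7Prop5Induction.Hyp154`, unit pv19), through the printed operator (140), kernel-checked

CITATION HEADER (lean-in-tree rule 2026-08-18).  Bib key `Balaban1985Averaging`; held PDF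
`paper:balaban1985-cmp98-averaging` (journal page = PDF page + 16); renders read as images for this module by
unit b07-g3 (pub-balaban PAPER SUB-CELL B07 gen 3, 2026-08-18): `…/1985-cmp98-averaging-p023-x2.png` (p. 39:
(140)), `p024-x2` (p. 40: (148) and its sentence), `p025-x2` (p. 41: (153), (154)).  SIBLING of the landed
modules `…B7Ineq148` (p. 40 (148) from (123) + analyticity, with the weight `Qpp` = (140) on ONE bond's
variable set) and `…B7Prop5Induction` ((149)ⱼ ⇒ (149)ⱼ₊₁ with (148) entering as the HYPOTHESIS FIELD
`Hyp154.ht₂ : t₂ ≤ (C″₁ · p) • Q″ r` over an ABSTRACT positive linear operator `Q″ : (B₁ → ℝ) →ₗ[ℝ] (B₂ → ℝ)`;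
its header: "here (148) is a hypothesis").  Nothing landed is edited or restated; both siblings are imported.

WHAT IS REPRODUCED.  p. 39 [PDF 23], (140): *"(Q″A)_c = Σ_{b⊂B(c₋)∪B(c₊)} L^{−d} A_b"* — typed here as the
linear operator `QppOp L d S` on bond functions, `S c` the finite set of bonds `b ⊂ B(c₋) ∪ B(c₊)` (only its
finiteness is used); p. 40 [PDF 24], (148): *"|⟨δC(V₀, A)/δA, δA⟩| ≦ C″₁|A|Q″|δA| (148) following easily from
general properties of the function C(V₀, A). The constant C″₁ depends on d and L."*; p. 41 [PDF 25]: the second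
term of (153), *"⟨(δC/δA)(Ū₀ʲ, L⁻¹Q_j(U₀)A + C_j(U₀, L⁻¹A)), L⁻¹Q_j(U₀)δA + L⁻¹⟨(δC_j/δA)(U₀, L⁻¹A), δA⟩⟩"*,
is estimated in line 1 of (154) by *"C″₁|L⁻¹Q_j(U₀)A + C_j(U₀, L⁻¹A)| · Q″|L⁻¹Q_j(U₀)δA + L⁻¹⟨(δC_j/δA)(U₀, L⁻¹A), δA⟩|"*
— i.e. by (148) applied, bond by bond, to the one-step remainder at the configuration `P` with increment `dP`.

WHAT IS PROVED (0 sorry; [folklore] = elementary order / norm bookkeeping, no content of the series):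
* `QppOp`, `QppOp_apply`, `QppOp_monotone` — (140) as a positive (= monotone) linear operator, the shape
  `OpFacts.monoQ''` / `Hyp154` of `B7Prop5Induction` asks for;
* `norm_restrict_le`, `Qpp_restrict` — the sup norm of the restriction of a configuration `P : B₁ → G` to the
  variables `S c` of one bond's remainder is `≤ ‖P‖`, and `B7Ineq148.Qpp` of the restricted increment is
  `(QppOp L d S ‖dP ·‖) c`;
* `ht2_of_ineq148Printed` — THE SEAM: if every bond's one-step remainder `C c : (S c → G) → F` satisfies the typed
  (148) `Ineq148Printed (C c) L d ρ C″₁` (e.g. by `B7Ineq148.ineq148Printed_of_123`), then for every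
  configuration `P` with `‖P‖ < ρ`, every `p ≥ ‖P‖` and every increment `dP`, the bond function
  `t₂ c := ‖dPair (C c) (P|_{S c}) (dP|_{S c})‖` satisfies `t₂ ≤ (C″₁ · p) • QppOp L d S (‖dP ·‖)` — literally the
  field `ht₂` of `B7Prop5Induction.Hyp154` with `Q'' := QppOp L d S`, `r := ‖dP ·‖`.
So, between the two siblings, (148) is no longer a free-standing hypothesis of the (149)-induction once Prop. 3's
(123) + analyticity are granted: the remaining printed inputs of `Hyp154` are (143)ⱼ, (149)ⱼ, (135), the chain
rule (153) and the operator facts, exactly as its docstring lists them.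

DIVERGENCE (recorded, not silent).  (i) The print's `|A|` in (148) is the global sup norm; `B7Ineq148` proves (148)
with the sup over the variables of `C_c` only (its docstring says so) — `norm_restrict_le` is the one-line
bridge, so the seam holds with the GLOBAL `p ≥ ‖P‖` that `Hyp154.hp` bounds.  (ii) `S c` is data: the geometry
"`b ⊂ B(c₋) ∪ B(c₊)`" is not modelled (as in both siblings), only used through finiteness.
VALUE = kernel certificate of a printed internal implication between two landed modules, NOT summit progress.
-/

noncomputable section

namespace Literature.MathematicalPhysics.QuantumFieldTheory.Balaban1983to89.B7Ineq148Seam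

open Literature.MathematicalPhysics.QuantumFieldTheory.Balaban1983to89.B7Ineq148 (dPair Qpp Ineq148Printed)

variable {B₁ B₂ : Type*}

/-! ## 1. The operator (140) -/

/-- (140), p. 39 [PDF 23]: *"(Q″A)_c = Σ_{b⊂B(c₋)∪B(c₊)} L^{−d} A_b"*, as a linear operator on bond functions;
`S c` = the finite set of bonds `b ⊂ B(c₋) ∪ B(c₊)`. [cite: Balaban1985Averaging, (140) p.39] -/
def QppOp (L : ℝ) (d : ℕ) (S : B₂ → Finset B₁) : (B₁ → ℝ) →ₗ[ℝ] (B₂ → ℝ) where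
  toFun f c := ∑ b ∈ S c, (L ^ d)⁻¹ * f b
  map_add' f g := by
    ext c
    simp only [Pi.add_apply, mul_add, Finset.sum_add_distrib]
  map_smul' a f := by
    ext c
    simp only [Pi.smul_apply, smul_eq_mul, RingHom.id_apply, Finset.mul_sum]
    exact Finset.sum_congr rfl fun b _ => by ring

/-- Unfolding of `QppOp` = (140). [folklore] -/
@[simp] theorem QppOp_apply (L : ℝ) (d : ℕ) (S : B₂ → Finset B₁) (f : B₁ → ℝ) (c : B₂) :
    QppOp L d S f c = ∑ b ∈ S c, (L ^ d)⁻¹ * f b := rfl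

/-- (140) is a positive operator: monotone on bond functions (for `L ≥ 0`) — the shape `OpFacts.monoQ''` of
`B7Prop5Induction`. [folklore] -/
theorem QppOp_monotone {L : ℝ} (hL : 0 ≤ L) (d : ℕ) (S : B₂ → Finset B₁) : Monotone (QppOp L d S) := by
  intro f g hfg c
  simp only [QppOp_apply]
  exact Finset.sum_le_sum fun b _ => mul_le_mul_of_nonneg_left (hfg b) (inv_nonneg.mpr (pow_nonneg hL d))

/-! ## 2. Restriction of a configuration to one bond's variables -/

variable {G : Type*}

/-- The restriction `P|_S` of a configuration on all bonds of `B₁` to the variables `b ∈ S` of one bond's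
one-step remainder (the variables `A_b, b ⊂ B(c₋) ∪ B(c₊)` of `C(V₀, A, c)`, Prop. 3 p. 36). [folklore] -/
def restrict (S : Finset B₁) (P : B₁ → G) : S → G := fun b => P b

/-- Unfolding of `restrict`. [folklore] -/
@[simp] theorem restrict_apply (S : Finset B₁) (P : B₁ → G) (b : S) : restrict S P b = P b := rfl

variable [NormedAddCommGroup G]

/-- `‖P|_S‖ ≤ ‖P‖` (sup norms; `B₁` finite). [folklore] -/
theorem norm_restrict_le [Fintype B₁] (S : Finset B₁) (P : B₁ → G) : ‖restrict S P‖ ≤ ‖P‖ :=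
  (pi_norm_le_iff_of_nonneg (norm_nonneg P)).2 fun b => norm_le_pi_norm P b

/-- `B7Ineq148.Qpp` of the restricted increment is the `c`-component of (140) applied to `‖dP ·‖`. [folklore] -/
theorem Qpp_restrict (L : ℝ) (d : ℕ) (S : B₂ → Finset B₁) (dP : B₁ → G) (c : B₂) :
    Qpp L d (restrict (S c) dP) = QppOp L d S (fun b => ‖dP b‖) c := by
  unfold Qpp
  rw [QppOp_apply, ← Finset.sum_coe_sort (S c)]
  rfl

/-! ## 3. The seam: typed (148) ⇒ `Hyp154.ht₂` -/

variable [NormedSpace ℂ G] {F : Type*} [NormedAddCommGroup F] [NormedSpace ℂ F]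

/-- **Typed (148) for every bond's one-step remainder ⇒ the hypothesis `ht₂` of `B7Prop5Induction.Hyp154`**
(line 1 of (154), second term of (153), p. 41): with `Q″ := QppOp L d S` ((140)), `r := ‖dP ·‖`,
`t₂ c := ‖dPair (C c) (P|_{S c}) (dP|_{S c})‖`, any `p ≥ ‖P‖` (the global sup norm, `Hyp154.hp`) and `‖P‖ < ρ`
(the domain recorded in `Ineq148Printed`): `t₂ ≤ (C″₁ · p) • Q″ r`.
[cite: Balaban1985Averaging, (148) p.40, (153)–(154) p.41] -/
theorem ht2_of_ineq148Printed [Fintype B₁] {L ρ C₁'' p : ℝ} {d : ℕ} (hL : 0 ≤ L) (hC₁'' : 0 ≤ C₁'')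
    (S : B₂ → Finset B₁) (C : (c : B₂) → (S c → G) → F)
    (h148 : ∀ c, Ineq148Printed (C c) L d ρ C₁'')
    (P dP : B₁ → G) (hP : ‖P‖ < ρ) (hp : ‖P‖ ≤ p) :
    (fun c => ‖dPair (C c) (restrict (S c) P) (restrict (S c) dP)‖) ≤
      (C₁'' * p) • QppOp L d S (fun b => ‖dP b‖) := by
  intro c
  have hPc : ‖restrict (S c) P‖ < ρ := (norm_restrict_le (S c) P).trans_lt hP
  have h := h148 c (restrict (S c) P) hPc (restrict (S c) dP)
  rw [Qpp_restrict] at h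
  have hQ : 0 ≤ QppOp L d S (fun b => ‖dP b‖) c := by
    rw [QppOp_apply]
    exact Finset.sum_nonneg fun b _ => mul_nonneg (inv_nonneg.mpr (pow_nonneg hL d)) (norm_nonneg _)
  have hPp : ‖restrict (S c) P‖ ≤ p := (norm_restrict_le (S c) P).trans hp
  simp only [Pi.smul_apply, smul_eq_mul]
  calc ‖dPair (C c) (restrict (S c) P) (restrict (S c) dP)‖
      ≤ C₁'' * ‖restrict (S c) P‖ * QppOp L d S (fun b => ‖dP b‖) c := h
    _ ≤ C₁'' * p * QppOp L d S (fun b => ‖dP b‖) c := by gcongr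

/-- The same seam fed by `B7Ineq148.ineq148Printed_of_123`: Prop. 3's (123) `|C(V₀, A, c)| ≤ C₁L²|A|²` +
analyticity on the polydisc `|A_b| < c₃` for every bond's remainder ⇒ `ht₂` with `C″₁ = 4C₁L^{d+2}` on `‖P‖ < ½c₃`.
[cite: Balaban1985Averaging, (123) p.36, (148) p.40, (153)–(154) p.41] -/
theorem ht2_of_123 [Fintype B₁] {L c₃ C₁ p : ℝ} {d : ℕ} (hL : 0 < L) (hC₁ : 0 ≤ C₁)
    (S : B₂ → Finset B₁) (C : (c : B₂) → (S c → G) → F)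
    (hC : ∀ c, DifferentiableOn ℂ (C c) (Metric.ball 0 c₃))
    (h123 : ∀ c, ∀ A ∈ Metric.ball (0 : S c → G) c₃, ‖C c A‖ ≤ C₁ * L ^ 2 * ‖A‖ ^ 2)
    (P dP : B₁ → G) (hP : ‖P‖ < c₃ / 2) (hp : ‖P‖ ≤ p) :
    (fun c => ‖dPair (C c) (restrict (S c) P) (restrict (S c) dP)‖) ≤
      ((4 * C₁ * L ^ (d + 2)) * p) • QppOp L d S (fun b => ‖dP b‖) :=
  ht2_of_ineq148Printed hL.le (by positivity) S C
    (fun c => B7Ineq148.ineq148Printed_of_123 hL hC₁ (hC c) (h123 c)) P dP hP hp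

end Literature.MathematicalPhysics.QuantumFieldTheory.Balaban1983to89.B7Ineq148Seam

end
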